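import Summits.Ventures.LatticeQCDFlow.Scaling.ReplicaExchangeStarFloor

/-!
HONEST FRAMING: exact (Metropolis-corrected) sampling algorithms for lattice gauge theory; figures
of merit are autocorrelation/cost numbers at stated couplings and volumes; no continuum-physics
claim.

# StarConveyorRotation — A POINCARÉ INEQUALITY FOR A CHAIN ON MODE ASSIGNMENTS `Fin (K+1) → J` WHOSE ONLY ASSUMED
# EDGES ARE STAR TRANSPOSITIONS `z ↦ z∘τ_k` (`τ_k = swap(0, k+1)`) AND RELABELLING AT THE HOT POSITION `0`, BY THE
# ROTATION PATHS `z → z^{0←v} → (z^{0←v})∘τ_k → z^{k+1←v}` (RELABEL, SWAP, RELABEL BACK): `C·Var_{ν⊗}(f) ≤ 𝓔_{ν⊗}(Q; f)`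
# FOR `C·6 ≤ pκ` AND `C·2(p + 6K) ≤ pρθ` — ONE-SIDED (HEATING) PERSISTENCE `p·ν_{k+1} ≤ ν_0` ONLY: NO COOLING FACTOR,
# NO MONOTONICITY, NO CONVEYOR LENGTH (lean-2 GEN-22, ours)

Venture-side (OURS).  Cell `lqcd-flow` (pub-lqcd), unit `pub-lqcd-lean-2-g22`, 2026-08-26.  Chapter J (the HUB
exchange scheme over METASTABLE cold replicas), file 1: the star counterpart of `Scaling/ConveyorPoincare` (C3, the
adjacent ladder: `(pD/(6(K+1)))·min{κ/K, ρθ}`, displacement factor `D = q^K`) and of `Scaling/ConveyorPoincareHeating`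
(C5b, `q`-free on MONOTONE sector ladders).  Along the "modes as blocks" decomposition of a HUB sampler (every cold
replica `k+1` exchanges directly with the hot replica `0`) the projection chain lives on assignments
`z : Fin (K+1) → J` with product law `ν⊗ = tensorFun ν`; an accepted hub swap TRANSPOSES the labels at positions `0`
and `k+1`, a sector-crossing hot update RELABELS position `0`.  This file bounds the Poincaré constant of ANY chain
`Q ≥ 0` on `Fin (K+1) → J` from: star-transposition conductance `κ` (`ν⊗(z)Q(z, z∘τ_k) ≥ κ·min{ν⊗(z), ν⊗(z∘τ_k)}`);
a hot comparison chain `Q₀` on `J` (`ρ·Var_{ν_0} ≤ 𝓔_{ν_0}(Q₀)`) dominated at the hot position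
(`θ·ν⊗(z)Q₀(z_0, v) ≤ ν⊗(z)Q(z, z^{0←v})`, `v ≠ z_0`); ONE-SIDED persistence `p·ν_{k+1}(j) ≤ ν_0(j)` (heating keeps the
fraction `p` of every mode's weight) — using for the cold position `k+1` the ROTATION path "relabel the hot position to
the fresh label `v`, swap it into position `k+1`, relabel the hot position back": every edge of the path is weighted by
the COLD law of the label it moves, which the hot law dominates; the reverse domination (cooling) never enters.

## What is proved

* §1 `update_succ_eq_rotation` (the path ends at `z^{k+1←v}`); the three legs **`star_rot_leg_relabel_le`**
  (`≤ p⁻¹·V₀`), **`star_rot_leg_swap_le`** (`≤ (pκ)⁻¹·T_k`), **`star_rot_leg_back_le`** (`≤ p⁻¹·V₀`), where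
  `V₀ = Σ_zΣ_v ν⊗(z)ν_0(v)(f z − f z^{0←v})²` and `T_k = Σ_z ν⊗(z)Q(z,z∘τ_k)(f z − f(z∘τ_k))²`; `hot_dirichlet_le`
  (`Σ_zΣ_v ν⊗(z)Q₀(z_0,v)(…)² ≤ (2/θ)·R`, `R` the kept relabel part of `𝓔`).
* §2 **`starConveyor_poincare`** — `C·Var_{ν⊗}(f) ≤ 𝓔_{ν⊗}(Q; f)` for every `f` and every `C ≥ 0` with `C·6 ≤ pκ`
  and `C·2(p + 6K) ≤ pρθ`; **`starConveyor_poincare_min`** — the Poincaré constant is at least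
  `p·min{κ/6, ρθ/(14K)}` (`K ≥ 1`, `p ≤ 1`).

Reading (no numerics implied): on the hub the transposition budget carries NO power of `K` (each cold position owns
its hub edge) and the relabel budget ONE power (the `K` cold positions share the hot position's edges); persistence is
paid once per leg and only in the heating direction.  NOT CLAIMED: sharp constants; anything about a specific sampler
(the next files of chapter J instantiate for the weighted hub scheme).  Literature grade (cell rule): KNOWN MECHANISM
(comparison paths for interchange processes, Diaconis–Saloff-Coste 1993; decomposition of swapping chains,
Woodard–Schmidler–Huber 2009), NEW TYPING (star topology, one-sided persistence, explicit constants); nothing cited as a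
fact; no new bib keys.
-/

noncomputable section

open Finset Function
open Literature.Probability.MarkovChains

namespace Summit.Ventures.LatticeQCDFlow.Scaling

variable {J : Type*} [Fintype J] [DecidableEq J] {K : ℕ} {ν : Fin (K + 1) → J → ℝ}

/-! ## §1 The rotation path and its three legs -/

omit [Fintype J] [DecidableEq J] in
/-- **The rotation path ends at the target:** `z^{k+1←v} = ((z^{0←v})∘τ_k)^{0←z_0}`. [ours] -/
theorem update_succ_eq_rotation (z : Fin (K + 1) → J) (k : Fin K) (v : J) :
    update z k.succ v
      = update ((update z 0 v) ∘ Equiv.swap (0 : Fin (K + 1)) k.succ) 0 (z 0) := by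
  have hne : (0 : Fin (K + 1)) ≠ k.succ := (Fin.succ_ne_zero k).symm
  funext i
  by_cases h0 : i = 0
  · subst h0; rw [update_of_ne hne, update_self]
  · rw [update_of_ne h0, Function.comp_apply]
    by_cases h1 : i = k.succ
    · subst h1; rw [update_self, Equiv.swap_apply_right, update_self]
    · rw [update_of_ne h1, Equiv.swap_apply_of_ne_of_ne h0 h1, update_of_ne h0]

section Legs

variable (hν : ∀ k j, 0 < ν k j) (hν1 : ∀ k, ∑ j, ν k j = 1) {p : ℝ} (hp : 0 < p)
  (hpers : ∀ (k : Fin K) (j : J), p * ν k.succ j ≤ ν 0 j)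
include hν hν1 hp hpers

omit [Fintype J] [DecidableEq J] hν hν1 in
/-- One-sided persistence as a ratio: `ν_{k+1}(j) ≤ p⁻¹·ν_0(j)`. [ours] -/
theorem cold_le_inv_mul_hot (k : Fin K) (j : J) : ν k.succ j ≤ 1 / p * ν 0 j := by
  rw [one_div, inv_mul_eq_div, le_div_iff₀ hp, mul_comm]; exact hpers k j

omit [DecidableEq J] hν1 in
/-- **THE FIRST LEG (relabel the hot position to the fresh label):**
`Σ_zΣ_v ν⊗(z)ν_{k+1}(v)(f z − f z^{0←v})² ≤ p⁻¹·V₀`. [ours] -/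
theorem star_rot_leg_relabel_le (f : (Fin (K + 1) → J) → ℝ) (k : Fin K) :
    ∑ z : Fin (K + 1) → J, ∑ v, tensorFun ν z * ν k.succ v * (f z - f (update z 0 v)) ^ 2
      ≤ 1 / p * ∑ z : Fin (K + 1) → J, ∑ v, tensorFun ν z * ν 0 v * (f z - f (update z 0 v)) ^ 2 := by
  rw [mul_sum]; refine sum_le_sum fun z _ => ?_
  rw [mul_sum]; refine sum_le_sum fun v _ => ?_
  have hz : 0 ≤ tensorFun ν z := (tensorFun_pos hν z).le
  calc tensorFun ν z * ν k.succ v * (f z - f (update z 0 v)) ^ 2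
      ≤ tensorFun ν z * (1 / p * ν 0 v) * (f z - f (update z 0 v)) ^ 2 :=
        mul_le_mul_of_nonneg_right (mul_le_mul_of_nonneg_left (cold_le_inv_mul_hot hp hpers k v) hz)
          (sq_nonneg _)
    _ = _ := by ring

omit hν1 in
/-- **THE SWAP LEG:** under the star-transposition conductance `κ`,
`Σ_zΣ_v ν⊗(z)ν_{k+1}(v)(f z^{0←v} − f(z^{0←v}∘τ_k))² ≤ (pκ)⁻¹·T_k` — after summing out `z_0` the edge `w → w∘τ_k`
(`w = z^{0←v}`) carries the weight `ν_{k+1}(w_0)·Π_{j}ν_{j+1}(w_{j+1})`, which is `≤ p⁻¹·min{ν⊗(w), ν⊗(w∘τ_k)}` by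
heating persistence at BOTH ends of the edge. [ours] -/
theorem star_rot_leg_swap_le (hν1' : ∑ j, ν 0 j = 1) {κ : ℝ} (hκ : 0 < κ)
    {Q : Matrix (Fin (K + 1) → J) (Fin (K + 1) → J) ℝ}
    (hT : ∀ (z : Fin (K + 1) → J) (k : Fin K), z ∘ Equiv.swap (0 : Fin (K + 1)) k.succ ≠ z →
      κ * min (tensorFun ν z) (tensorFun ν (z ∘ Equiv.swap (0 : Fin (K + 1)) k.succ))
        ≤ tensorFun ν z * Q z (z ∘ Equiv.swap (0 : Fin (K + 1)) k.succ))
    (f : (Fin (K + 1) → J) → ℝ) (k : Fin K) :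
    ∑ z : Fin (K + 1) → J, ∑ v, tensorFun ν z * ν k.succ v
        * (f (update z 0 v) - f ((update z 0 v) ∘ Equiv.swap (0 : Fin (K + 1)) k.succ)) ^ 2
      ≤ 1 / (p * κ) * ∑ w : Fin (K + 1) → J, tensorFun ν w * Q w (w ∘ Equiv.swap (0 : Fin (K + 1)) k.succ)
          * (f w - f (w ∘ Equiv.swap (0 : Fin (K + 1)) k.succ)) ^ 2 := by
  set R : (Fin K → J) → ℝ := fun r => ∏ j : Fin K, ν j.succ (r j) with hR
  set G : J → (Fin K → J) → ℝ := fun v r =>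
    (f (Fin.cons v r) - f ((Fin.cons v r : Fin (K + 1) → J) ∘ Equiv.swap (0 : Fin (K + 1)) k.succ)) ^ 2 with hG
  have hR0 : ∀ r, 0 ≤ R r := fun r => prod_nonneg fun j _ => (hν _ _).le
  have hG0 : ∀ v r, 0 ≤ G v r := fun v r => sq_nonneg _
  have L : ∑ z : Fin (K + 1) → J, ∑ v, tensorFun ν z * ν k.succ v
        * (f (update z 0 v) - f ((update z 0 v) ∘ Equiv.swap (0 : Fin (K + 1)) k.succ)) ^ 2
      = ∑ v, ∑ r : Fin K → J, R r * ν k.succ v * G v r := by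
    rw [sum_state_eq_sum_cons]
    have e : ∀ (a : J) (r : Fin K → J), (∑ v, tensorFun ν (Fin.cons a r) * ν k.succ v
        * (f (update (Fin.cons a r : Fin (K + 1) → J) 0 v)
          - f ((update (Fin.cons a r : Fin (K + 1) → J) 0 v) ∘ Equiv.swap (0 : Fin (K + 1)) k.succ)) ^ 2)
        = ν 0 a * ∑ v, R r * ν k.succ v * G v r := by
      intro a r
      rw [mul_sum]
      refine sum_congr rfl fun v _ => ?_
      rw [Fin.update_cons_zero, tensorFun_cons_succProd]
      simp only [hG, hR]; ring
    rw [sum_congr rfl fun a _ => sum_congr rfl fun r _ => e a r]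
    calc ∑ a, ∑ r : Fin K → J, ν 0 a * ∑ v, R r * ν k.succ v * G v r
        = (∑ a, ν 0 a) * ∑ r : Fin K → J, ∑ v, R r * ν k.succ v * G v r := by
          rw [sum_mul]; exact sum_congr rfl fun a _ => by rw [mul_sum]
      _ = ∑ v, ∑ r : Fin K → J, R r * ν k.succ v * G v r := by rw [hν1', one_mul, sum_comm]
  have D : ∀ (v : J) (r : Fin K → J), R r * ν k.succ v * G v r
      ≤ 1 / (p * κ) * (tensorFun ν (Fin.cons v r)
          * Q (Fin.cons v r) ((Fin.cons v r : Fin (K + 1) → J) ∘ Equiv.swap (0 : Fin (K + 1)) k.succ) * G v r) := by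
    intro v r
    by_cases hfix : (Fin.cons v r : Fin (K + 1) → J) ∘ Equiv.swap (0 : Fin (K + 1)) k.succ = Fin.cons v r
    · have : G v r = 0 := by simp only [hG]; rw [hfix, sub_self]; ring
      rw [this]; simp
    · have hcap := hT (Fin.cons v r) k hfix
      have h1 : p * (R r * ν k.succ v) ≤ tensorFun ν (Fin.cons v r) := by
        rw [tensorFun_cons_succProd]
        calc p * (R r * ν k.succ v) = (p * ν k.succ v) * R r := by ring
          _ ≤ ν 0 v * R r := mul_le_mul_of_nonneg_right (hpers k v) (hR0 r)
      have h2 : p * (R r * ν k.succ v)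
          ≤ tensorFun ν ((Fin.cons v r : Fin (K + 1) → J) ∘ Equiv.swap (0 : Fin (K + 1)) k.succ) := by
        rw [cons_comp_swap_zero_succ, tensorFun_cons_succProd]
        have e := prod_succ_update_mul ν r k v
        calc p * (R r * ν k.succ v) = p * ((∏ j : Fin K, ν j.succ (update r k v j)) * ν k.succ (r k)) := by
              rw [hR]; simp only; rw [e]
          _ = (p * ν k.succ (r k)) * ∏ j : Fin K, ν j.succ (update r k v j) := by ring
          _ ≤ ν 0 (r k) * ∏ j : Fin K, ν j.succ (update r k v j) :=
              mul_le_mul_of_nonneg_right (hpers k (r k)) (prod_nonneg fun j _ => (hν _ _).le)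
      have key : p * κ * (R r * ν k.succ v) ≤ tensorFun ν (Fin.cons v r)
          * Q (Fin.cons v r) ((Fin.cons v r : Fin (K + 1) → J) ∘ Equiv.swap (0 : Fin (K + 1)) k.succ) :=
        le_trans (by rw [mul_comm p κ, mul_assoc]; exact mul_le_mul_of_nonneg_left (le_min h1 h2) hκ.le) hcap
      have hpk : 0 < p * κ := mul_pos hp hκ
      calc R r * ν k.succ v * G v r = 1 / (p * κ) * (p * κ * (R r * ν k.succ v)) * G v r := by field_simp
        _ ≤ 1 / (p * κ) * (tensorFun ν (Fin.cons v r)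
            * Q (Fin.cons v r) ((Fin.cons v r : Fin (K + 1) → J) ∘ Equiv.swap (0 : Fin (K + 1)) k.succ)) * G v r :=
            mul_le_mul_of_nonneg_right (mul_le_mul_of_nonneg_left key (by positivity)) (hG0 v r)
        _ = _ := by ring
  rw [L, sum_state_eq_sum_cons (fun w => tensorFun ν w * Q w (w ∘ Equiv.swap (0 : Fin (K + 1)) k.succ)
    * (f w - f (w ∘ Equiv.swap (0 : Fin (K + 1)) k.succ)) ^ 2), mul_sum]
  refine sum_le_sum fun v _ => ?_
  rw [mul_sum]
  exact sum_le_sum fun r _ => D v r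

omit hν1 in
/-- **THE BACK LEG (relabel the hot position back to the old label):**
`Σ_zΣ_v ν⊗(z)ν_{k+1}(v)(f(z^{0←v}∘τ_k) − f(((z^{0←v})∘τ_k)^{0←z_0}))² ≤ p⁻¹·V₀` — reindex along the involution
`(v, r) ↦ (r_k, r^{k←v})` of `Scaling/ReplicaExchangeStarLegs`, then heating persistence once. [ours] -/
theorem star_rot_leg_back_le (f : (Fin (K + 1) → J) → ℝ) (k : Fin K) :
    ∑ z : Fin (K + 1) → J, ∑ v, tensorFun ν z * ν k.succ v
        * (f ((update z 0 v) ∘ Equiv.swap (0 : Fin (K + 1)) k.succ)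
          - f (update ((update z 0 v) ∘ Equiv.swap (0 : Fin (K + 1)) k.succ) 0 (z 0))) ^ 2
      ≤ 1 / p * ∑ z : Fin (K + 1) → J, ∑ v, tensorFun ν z * ν 0 v * (f z - f (update z 0 v)) ^ 2 := by
  set R : (Fin K → J) → ℝ := fun r => ∏ j : Fin K, ν j.succ (r j) with hR
  set F : J → (Fin K → J) → ℝ := fun b r => f (Fin.cons b r) with hF
  have hR0 : ∀ r, 0 ≤ R r := fun r => prod_nonneg fun j _ => (hν _ _).le
  have L : ∑ z : Fin (K + 1) → J, ∑ v, tensorFun ν z * ν k.succ v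
        * (f ((update z 0 v) ∘ Equiv.swap (0 : Fin (K + 1)) k.succ)
          - f (update ((update z 0 v) ∘ Equiv.swap (0 : Fin (K + 1)) k.succ) 0 (z 0))) ^ 2
      = ∑ a, ∑ b, ∑ r' : Fin K → J, ν 0 a * (R (update r' k b) * ν k.succ (r' k)) * (F b r' - F a r') ^ 2 := by
    rw [sum_state_eq_sum_cons]
    refine sum_congr rfl fun a _ => ?_
    have e : ∀ r : Fin K → J, (∑ v, tensorFun ν (Fin.cons a r) * ν k.succ v
        * (f ((update (Fin.cons a r : Fin (K + 1) → J) 0 v) ∘ Equiv.swap (0 : Fin (K + 1)) k.succ)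
          - f (update ((update (Fin.cons a r : Fin (K + 1) → J) 0 v) ∘ Equiv.swap (0 : Fin (K + 1)) k.succ) 0
              ((Fin.cons a r : Fin (K + 1) → J) 0))) ^ 2)
        = ∑ v, ν 0 a * (R r * ν k.succ v) * (F (r k) (update r k v) - F a (update r k v)) ^ 2 := by
      intro r
      refine sum_congr rfl fun v _ => ?_
      rw [Fin.update_cons_zero, cons_comp_swap_zero_succ, Fin.cons_zero, Fin.update_cons_zero, tensorFun_cons_succProd]
      simp only [hF, hR]; ring
    rw [sum_congr rfl fun r _ => e r, sum_comm,
      sum_pair_reindex k (fun v r => ν 0 a * (R r * ν k.succ v) * (F (r k) (update r k v) - F a (update r k v)) ^ 2)]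
    simp only [update_self, update_idem, update_eq_self]
  have W : ∀ (b : J) (r' : Fin K → J), R (update r' k b) * ν k.succ (r' k) ≤ 1 / p * (ν 0 b * R r') := by
    intro b r'
    have e := prod_succ_update_mul ν r' k b
    calc R (update r' k b) * ν k.succ (r' k) = R r' * ν k.succ b := by rw [hR]; simp only; rw [e]
      _ ≤ R r' * (1 / p * ν 0 b) := mul_le_mul_of_nonneg_left (cold_le_inv_mul_hot hp hpers k b) (hR0 r')
      _ = _ := by ring
  rw [L, sum_state_eq_sum_cons (fun z => ∑ v, tensorFun ν z * ν 0 v * (f z - f (update z 0 v)) ^ 2)]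
  simp only [Fin.update_cons_zero, tensorFun_cons_succProd]
  calc ∑ a, ∑ b, ∑ r' : Fin K → J, ν 0 a * (R (update r' k b) * ν k.succ (r' k)) * (F b r' - F a r') ^ 2
      ≤ ∑ a, ∑ b, ∑ r' : Fin K → J, ν 0 a * (1 / p * (ν 0 b * R r')) * (F b r' - F a r') ^ 2 :=
        sum_le_sum fun a _ => sum_le_sum fun b _ => sum_le_sum fun r' _ =>
          mul_le_mul_of_nonneg_right (mul_le_mul_of_nonneg_left (W b r') (hν _ _).le) (sq_nonneg _)
    _ = 1 / p * ∑ b, ∑ r' : Fin K → J, ∑ a, ν 0 b * R r' * ν 0 a * (F b r' - F a r') ^ 2 := by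
        rw [sum_comm, mul_sum]
        refine sum_congr rfl fun b _ => ?_
        rw [sum_comm, mul_sum]
        refine sum_congr rfl fun r' _ => ?_
        rw [mul_sum]
        exact sum_congr rfl fun a _ => by ring
    _ = 1 / p * ∑ b, ∑ r' : Fin K → J, ∑ a, ν 0 b * (∏ j : Fin K, ν j.succ (r' j)) * ν 0 a
          * (f (Fin.cons b r') - f (Fin.cons a r')) ^ 2 := by
        simp only [hF, hR]

omit hν hν1 hp hpers in
/-- **The hot comparison chain is dominated at the hot position:** `Σ_zΣ_v ν⊗(z)Q₀(z_0,v)(f z − f z^{0←v})² ≤ (2/θ)·R`,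
`R = ½Σ_zΣ_v ν⊗(z)Q(z,z^{0←v})(f z − f z^{0←v})²`. [ours] -/
theorem hot_dirichlet_le {θ : ℝ} (hθ : 0 < θ) {Q : Matrix (Fin (K + 1) → J) (Fin (K + 1) → J) ℝ}
    {Q₀ : Matrix J J ℝ}
    (hR : ∀ (z : Fin (K + 1) → J) (v : J), v ≠ z 0 → θ * (tensorFun ν z * Q₀ (z 0) v) ≤ tensorFun ν z * Q z (update z 0 v))
    (f : (Fin (K + 1) → J) → ℝ) :
    ∑ z : Fin (K + 1) → J, ∑ v, tensorFun ν z * Q₀ (z 0) v * (f z - f (update z 0 v)) ^ 2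
      ≤ 2 / θ * ((1 / 2) * ∑ z : Fin (K + 1) → J, ∑ v,
          tensorFun ν z * Q z (update z 0 v) * (f z - f (update z 0 v)) ^ 2) := by
  rw [← mul_assoc, show 2 / θ * (1 / 2 : ℝ) = 1 / θ by ring, mul_sum]
  refine sum_le_sum fun z _ => ?_
  rw [mul_sum]
  refine sum_le_sum fun v _ => ?_
  by_cases hv : v = z 0
  · rw [hv, update_eq_self, sub_self]; simp
  · calc tensorFun ν z * Q₀ (z 0) v * (f z - f (update z 0 v)) ^ 2
        = 1 / θ * (θ * (tensorFun ν z * Q₀ (z 0) v)) * (f z - f (update z 0 v)) ^ 2 := by field_simp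
      _ ≤ 1 / θ * (tensorFun ν z * Q z (update z 0 v)) * (f z - f (update z 0 v)) ^ 2 :=
          mul_le_mul_of_nonneg_right (mul_le_mul_of_nonneg_left (hR z v hv) (by positivity)) (sq_nonneg _)
      _ = _ := by ring

/-! ## §2 The star-conveyor Poincaré inequality -/

set_option maxHeartbeats 400000 in
/-- **THE STAR-CONVEYOR POINCARÉ INEQUALITY (rotation paths, one-sided persistence).**  Let `Q ≥ 0` be a chain on
`Fin (K+1) → J` and `ν_k > 0` probability vectors with: star-transposition flows
`ν⊗(z)Q(z, z∘τ_k) ≥ κ·min{ν⊗(z), ν⊗(z∘τ_k)}` (`τ_k = swap(0,k+1)`); a `ν_0`-chain `Q₀` with `ρ·Var_{ν_0} ≤ 𝓔_{ν_0}(Q₀)`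
dominated at the hot position, `θ·ν⊗(z)Q₀(z_0,v) ≤ ν⊗(z)Q(z, z^{0←v})` (`v ≠ z_0`); heating persistence
`p·ν_{k+1}(j) ≤ ν_0(j)`.  Then **`C·Var_{ν⊗}(f) ≤ 𝓔_{ν⊗}(Q; f)` for every `f` and every `C ≥ 0` with `C·6 ≤ pκ` and
`C·2(p + 6K) ≤ pρθ`.** [ours] -/
theorem starConveyor_poincare {κ ρ θ : ℝ} (hκ : 0 < κ) (hρ : 0 < ρ) (hθ : 0 < θ)
    {Q : Matrix (Fin (K + 1) → J) (Fin (K + 1) → J) ℝ} (hQ0 : ∀ z y, 0 ≤ Q z y)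
    (hT : ∀ (z : Fin (K + 1) → J) (k : Fin K), z ∘ Equiv.swap (0 : Fin (K + 1)) k.succ ≠ z →
      κ * min (tensorFun ν z) (tensorFun ν (z ∘ Equiv.swap (0 : Fin (K + 1)) k.succ))
        ≤ tensorFun ν z * Q z (z ∘ Equiv.swap (0 : Fin (K + 1)) k.succ))
    {Q₀ : Matrix J J ℝ} (hρvar : ∀ h : J → ℝ, ρ * lawVariance (ν 0) h ≤ dirichletForm (ν 0) Q₀ h)
    (hR : ∀ (z : Fin (K + 1) → J) (v : J), v ≠ z 0 → θ * (tensorFun ν z * Q₀ (z 0) v) ≤ tensorFun ν z * Q z (update z 0 v))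
    (f : (Fin (K + 1) → J) → ℝ) {C : ℝ} (hC0 : 0 ≤ C) (hC1 : C * 6 ≤ p * κ)
    (hC2 : C * (2 * (p + 6 * K)) ≤ p * ρ * θ) :
    C * lawVariance (tensorFun ν) f ≤ dirichletForm (tensorFun ν) Q f := by
  have hW0 : ∀ z, 0 ≤ tensorFun ν z := fun z => (tensorFun_pos hν z).le
  -- the kept quantities
  set Sk : Fin K → ℝ := fun k => ∑ w : Fin (K + 1) → J, tensorFun ν w * Q w (w ∘ Equiv.swap (0 : Fin (K + 1)) k.succ)
    * (f w - f (w ∘ Equiv.swap (0 : Fin (K + 1)) k.succ)) ^ 2 with hSk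
  set T : ℝ := ∑ k : Fin K, Sk k with hTdef
  set Rk : ℝ := (1 / 2) * ∑ z : Fin (K + 1) → J, ∑ v,
    tensorFun ν z * Q z (update z 0 v) * (f z - f (update z 0 v)) ^ 2 with hRdef
  set V₀ : ℝ := ∑ z : Fin (K + 1) → J, ∑ v, tensorFun ν z * ν 0 v * (f z - f (update z 0 v)) ^ 2 with hV₀
  set U : ℝ := ∑ z : Fin (K + 1) → J, ∑ v, tensorFun ν z * Q₀ (z 0) v * (f z - f (update z 0 v)) ^ 2 with hU
  have hTle : (1 / 2) * T ≤ dirichletForm (tensorFun ν) Q f := by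
    rw [hTdef, hSk]; exact half_sum_starSwap_le_dirichletForm hW0 hQ0 f
  have hRle : Rk ≤ dirichletForm (tensorFun ν) Q f := half_sum_relabel_le_dirichletForm hW0 hQ0 f
  have hSk0 : ∀ k, 0 ≤ Sk k := fun k => sum_nonneg fun w _ => mul_nonneg (mul_nonneg (hW0 w) (hQ0 _ _)) (sq_nonneg _)
  have hT0 : 0 ≤ T := sum_nonneg fun k _ => hSk0 k
  have hR0 : 0 ≤ Rk := mul_nonneg (by norm_num) (sum_nonneg fun z _ => sum_nonneg fun v _ =>
    mul_nonneg (mul_nonneg (hW0 z) (hQ0 _ _)) (sq_nonneg _))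
  have hVU : V₀ ≤ 1 / ρ * U := star_hot_variance_le (μ := ν) hν1 (fun k j => (hν k j).le) hρ hρvar f
  have hUR : U ≤ 2 / θ * Rk := hot_dirichlet_le hθ hR f
  have hVR : V₀ ≤ 2 / (ρ * θ) * Rk :=
    calc V₀ ≤ 1 / ρ * U := hVU
      _ ≤ 1 / ρ * (2 / θ * Rk) := mul_le_mul_of_nonneg_left hUR (by positivity)
      _ = 2 / (ρ * θ) * Rk := by field_simp
  have hsplit : ∀ k : Fin K, ∑ z : Fin (K + 1) → J, ∑ v,
      tensorFun ν z * ν k.succ v * (f z - f (update z k.succ v)) ^ 2 ≤ 6 / p * V₀ + 3 / (p * κ) * Sk k := by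
    intro k
    have L1 := star_rot_leg_relabel_le hν hp hpers f k
    have L2 := star_rot_leg_swap_le hν hp hpers (hν1 0) hκ hT f k
    have L3 := star_rot_leg_back_le hν hp hpers f k
    rw [← hV₀] at L1 L3
    have hL2 : ∑ z : Fin (K + 1) → J, ∑ v, tensorFun ν z * ν k.succ v
        * (f (update z 0 v) - f ((update z 0 v) ∘ Equiv.swap (0 : Fin (K + 1)) k.succ)) ^ 2 ≤ 1 / (p * κ) * Sk k := by
      rw [hSk]; exact L2
    have hpt : ∀ (z : Fin (K + 1) → J) (v : J), tensorFun ν z * ν k.succ v * (f z - f (update z k.succ v)) ^ 2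
        ≤ 3 * (tensorFun ν z * ν k.succ v * (f z - f (update z 0 v)) ^ 2
          + tensorFun ν z * ν k.succ v
              * (f (update z 0 v) - f ((update z 0 v) ∘ Equiv.swap (0 : Fin (K + 1)) k.succ)) ^ 2
          + tensorFun ν z * ν k.succ v * (f ((update z 0 v) ∘ Equiv.swap (0 : Fin (K + 1)) k.succ)
              - f (update ((update z 0 v) ∘ Equiv.swap (0 : Fin (K + 1)) k.succ) 0 (z 0))) ^ 2) := by
      intro z v
      rw [update_succ_eq_rotation z k v]
      have hw : 0 ≤ tensorFun ν z * ν k.succ v := mul_nonneg (hW0 z) (hν _ _).le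
      have h3 := mul_sq_add_add_le_three hw (f z - f (update z 0 v))
        (f (update z 0 v) - f ((update z 0 v) ∘ Equiv.swap (0 : Fin (K + 1)) k.succ))
        (f ((update z 0 v) ∘ Equiv.swap (0 : Fin (K + 1)) k.succ)
          - f (update ((update z 0 v) ∘ Equiv.swap (0 : Fin (K + 1)) k.succ) 0 (z 0)))
      have e : f z - f (update ((update z 0 v) ∘ Equiv.swap (0 : Fin (K + 1)) k.succ) 0 (z 0))
          = (f z - f (update z 0 v))
            + (f (update z 0 v) - f ((update z 0 v) ∘ Equiv.swap (0 : Fin (K + 1)) k.succ))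
            + (f ((update z 0 v) ∘ Equiv.swap (0 : Fin (K + 1)) k.succ)
              - f (update ((update z 0 v) ∘ Equiv.swap (0 : Fin (K + 1)) k.succ) 0 (z 0))) := by ring
      rw [e]
      nlinarith [h3]
    have hsum := sum_le_sum fun z (_ : z ∈ (univ : Finset (Fin (K + 1) → J))) =>
      sum_le_sum fun v (_ : v ∈ (univ : Finset J)) => hpt z v
    simp only [Finset.sum_add_distrib, ← Finset.mul_sum] at hsum
    have hκp : 0 < p * κ := mul_pos hp hκ
    calc ∑ z : Fin (K + 1) → J, ∑ v, tensorFun ν z * ν k.succ v * (f z - f (update z k.succ v)) ^ 2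
        ≤ 3 * (1 / p * V₀ + 1 / (p * κ) * Sk k + 1 / p * V₀) := le_trans hsum (by nlinarith [L1, hL2, L3])
      _ = _ := by ring
  have ES := efronStein_tensorFun (ν := ν) (fun k j => (hν k j).le) hν1 f
  rw [Fin.sum_univ_succ] at ES
  have hcold : ∑ k : Fin K, (1 / 2) * ∑ z : Fin (K + 1) → J, ∑ v,
      tensorFun ν z * ν k.succ v * (f z - f (update z k.succ v)) ^ 2 ≤ 3 * K / p * V₀ + 3 / (2 * (p * κ)) * T := by
    calc ∑ k : Fin K, (1 / 2) * ∑ z : Fin (K + 1) → J, ∑ v,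
          tensorFun ν z * ν k.succ v * (f z - f (update z k.succ v)) ^ 2
        ≤ ∑ k : Fin K, (1 / 2) * (6 / p * V₀ + 3 / (p * κ) * Sk k) :=
          sum_le_sum fun k _ => mul_le_mul_of_nonneg_left (hsplit k) (by norm_num)
      _ = ∑ k : Fin K, (3 / p * V₀ + 3 / (2 * (p * κ)) * Sk k) := sum_congr rfl fun k _ => by ring
      _ = 3 * K / p * V₀ + 3 / (2 * (p * κ)) * T := by
          have e3 : ∑ k : Fin K, 3 / (2 * (p * κ)) * Sk k = 3 / (2 * (p * κ)) * T := by rw [hTdef, mul_sum]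
          rw [sum_add_distrib, sum_const, card_univ, Fintype.card_fin, nsmul_eq_mul, e3]
          ring
  have hVar : lawVariance (tensorFun ν) f ≤ (p + 6 * K) / (p * (ρ * θ)) * Rk + 3 / (2 * (p * κ)) * T := by
    have h1 : lawVariance (tensorFun ν) f ≤ (1 / 2 + 3 * K / p) * V₀ + 3 / (2 * (p * κ)) * T := by
      rw [← hV₀] at ES
      nlinarith [ES, hcold]
    have h2 : (1 / 2 + 3 * K / p) * V₀ ≤ (1 / 2 + 3 * K / p) * (2 / (ρ * θ) * Rk) :=
      mul_le_mul_of_nonneg_left hVR (by positivity)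
    have e : (1 / 2 + 3 * K / p) * (2 / (ρ * θ) * Rk) = (p + 6 * K) / (p * (ρ * θ)) * Rk := by
      field_simp
      ring
    linarith
  have hall : 0 < p * (ρ * θ) := by positivity
  have hκp : 0 < p * κ := mul_pos hp hκ
  have k1 : C * ((p + 6 * K) / (p * (ρ * θ)) * Rk) ≤ Rk / 2 := by
    have e1 : C * ((p + 6 * K) / (p * (ρ * θ)) * Rk) = (C * (2 * (p + 6 * K))) / (p * ρ * θ) * (Rk / 2) := by
      field_simp
    rw [e1]
    have : (C * (2 * (p + 6 * K))) / (p * ρ * θ) ≤ 1 := by rw [div_le_one (by positivity)]; exact hC2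
    nlinarith
  have k2 : C * (3 / (2 * (p * κ)) * T) ≤ T / 4 := by
    have e2 : C * (3 / (2 * (p * κ)) * T) = (C * 6) / (p * κ) * (T / 4) := by
      field_simp
      ring
    rw [e2]
    have : (C * 6) / (p * κ) ≤ 1 := by rw [div_le_one hκp]; exact hC1
    nlinarith
  calc C * lawVariance (tensorFun ν) f
      ≤ C * ((p + 6 * K) / (p * (ρ * θ)) * Rk + 3 / (2 * (p * κ)) * T) := mul_le_mul_of_nonneg_left hVar hC0
    _ = C * ((p + 6 * K) / (p * (ρ * θ)) * Rk) + C * (3 / (2 * (p * κ)) * T) := by ring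
    _ ≤ Rk / 2 + T / 4 := add_le_add k1 k2
    _ ≤ dirichletForm (tensorFun ν) Q f := by linarith [hTle, hRle]

/-- **THE STAR-CONVEYOR POINCARÉ CONSTANT IS AT LEAST `p·min{κ/6, ρθ/(14K)}`** (`K ≥ 1`, `p ≤ 1`): one-sided
persistence, no power of `K` on the transposition side, one power on the relabel side. [ours] -/
theorem starConveyor_poincare_min (hK : 1 ≤ K) (hp1 : p ≤ 1) {κ ρ θ : ℝ} (hκ : 0 < κ) (hρ : 0 < ρ) (hθ : 0 < θ)
    {Q : Matrix (Fin (K + 1) → J) (Fin (K + 1) → J) ℝ} (hQ0 : ∀ z y, 0 ≤ Q z y)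
    (hT : ∀ (z : Fin (K + 1) → J) (k : Fin K), z ∘ Equiv.swap (0 : Fin (K + 1)) k.succ ≠ z →
      κ * min (tensorFun ν z) (tensorFun ν (z ∘ Equiv.swap (0 : Fin (K + 1)) k.succ))
        ≤ tensorFun ν z * Q z (z ∘ Equiv.swap (0 : Fin (K + 1)) k.succ))
    {Q₀ : Matrix J J ℝ} (hρvar : ∀ h : J → ℝ, ρ * lawVariance (ν 0) h ≤ dirichletForm (ν 0) Q₀ h)
    (hR : ∀ (z : Fin (K + 1) → J) (v : J), v ≠ z 0 → θ * (tensorFun ν z * Q₀ (z 0) v) ≤ tensorFun ν z * Q z (update z 0 v))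
    (f : (Fin (K + 1) → J) → ℝ) :
    p * min (κ / 6) (ρ * θ / (14 * K)) * lawVariance (tensorFun ν) f ≤ dirichletForm (tensorFun ν) Q f := by
  have hKr : (1 : ℝ) ≤ K := by exact_mod_cast hK
  set m₀ := min (κ / 6) (ρ * θ / (14 * K)) with hm₀
  have hm₀pos : 0 < m₀ := lt_min (by positivity) (by positivity)
  refine starConveyor_poincare hν hν1 hp hpers hκ hρ hθ hQ0 hT hρvar hR f (by positivity) ?_ ?_
  · have h1 : m₀ ≤ κ / 6 := min_le_left _ _
    calc p * m₀ * 6 ≤ p * (κ / 6) * 6 := by nlinarith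
      _ = p * κ := by ring
  · have h2 : m₀ ≤ ρ * θ / (14 * K) := min_le_right _ _
    have h3 : 2 * (p + 6 * (K : ℝ)) ≤ 14 * K := by nlinarith
    calc p * m₀ * (2 * (p + 6 * K)) ≤ p * (ρ * θ / (14 * K)) * (14 * K) := by
          have := mul_le_mul h2 h3 (by positivity) (by positivity)
          nlinarith
      _ = p * ρ * θ := by field_simp

end Legs

end Summit.Ventures.LatticeQCDFlow.Scaling

end
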